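import Mathlib.Analysis.SpecialFunctions.Exp
import Mathlib.Analysis.SpecificLimits.Basic
import Literature.Probability.LatticeModels.PSContourSetup
import HarnessLib

/-!
# Pirogov–Sinai theory, III: the corner encoding and boundary geometry

Topic `Literature/Probability/LatticeModels`. Geometric preliminaries for transporting the contour
polymer models of Friedli–Velenik Ch. 7 (compatibility = supports at `d_∞`-distance `> 1`,
FV Def. 7.21 and eq. (7.34)) to the subset-polymer framework of `PolymerPressure.lean`
(incompatibility = meeting), and for the boundary terms of the cluster expansion (FV Thm. 7.29,
eq. (7.54)):

* the **corner encoding** `cs A = A + {0,1}^d`: two finite sets are at `d_∞`-distance `≤ 1` iff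
  their encodings meet (`not_disjoint_cs_iff`); `d_∞(A, Vᶜ) > 1` iff `cs A ⊆ Vhat V`,
  `Vhat V = ⋂_{a ∈ {0,1}^d} (V + a)` (`biUnion_starBall_subset_iff`); the encoding of a
  `★`-connected set is nearest-neighbour connected (`isRConnected_cs`);
* the **boundary layers**: `V ∖ Vhat V ⊆ ∂^in V`, `∂^in (Vhat V)` has at most `3^d |∂^in V|` points,
  the `d_∞`-geodesic lemma (from a point of `T` to a point outside `T` one passes `∂^in T`),
  and the exponential boundary sum `Σ_{x ∈ T} e^{-δ d_∞(x, b)} ≤ 2` for `δ ≥ 2d + 1`;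
* the hull of a contour lies in the coordinate box of its support, so `|hull γ| ≤ |γ̄|^d`
  (the trivial isoperimetry used for "unstable contours are large", FV §7.4.3).

Everything is proved; no named facts.

## References

* S. Friedli, Y. Velenik, *Statistical Mechanics of Lattice Systems*, CUP 2017, §7.3
  (Def. 7.21, eq. (7.34), remark after (7.34): "similar to §5.7.1 with a different distance"),
  Thm. 7.29 and eq. (7.54) (boundary terms), §7.4.3. [FriedliVelenik2017]
-/

noncomputable section

open Finset Relation

namespace Literature.Probability.LatticeModels

variable {d : ℕ}

/-! ### The corner encoding `A + {0,1}^d` -/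

/-- The unit corner cube `{0,1}^d`. [folklore] -/
def cube01 (d : ℕ) : Finset (Site d) := Fintype.piFinset fun _ => ({0, 1} : Finset ℤ)

/-- Membership in `{0,1}^d`. [folklore] -/
theorem mem_cube01 {a : Site d} : a ∈ cube01 d ↔ ∀ i, a i = 0 ∨ a i = 1 := by
  simp [cube01, Fintype.mem_piFinset]

/-- `0 ∈ {0,1}^d`. [folklore] -/
theorem zero_mem_cube01 (d : ℕ) : (0 : Site d) ∈ cube01 d := mem_cube01.2 fun _ => Or.inl rfl

/-- `|{0,1}^d| = 2^d`. [folklore] -/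
theorem card_cube01 (d : ℕ) : #(cube01 d) = 2 ^ d := by
  rw [cube01, Fintype.card_piFinset_const]
  simp

/-- **The corner encoding** `cs A = A + {0,1}^d` of a finite set of lattice points.
[cite: FriedliVelenik2017, §7.3 (remark after eq. (7.34): the hard core for the distance d_∞)] -/
def cs (A : Finset (Site d)) : Finset (Site d) := (A ×ˢ cube01 d).image fun p => p.1 + p.2

/-- Membership in the corner encoding. [folklore] -/
theorem mem_cs {A : Finset (Site d)} {y : Site d} : y ∈ cs A ↔ ∃ x ∈ A, ∃ a ∈ cube01 d, y = x + a := by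
  simp only [cs, mem_image, mem_product, Prod.exists]
  constructor
  · rintro ⟨x, a, ⟨hx, ha⟩, rfl⟩; exact ⟨x, hx, a, ha, rfl⟩
  · rintro ⟨x, hx, a, ha, rfl⟩; exact ⟨x, a, ⟨hx, ha⟩, rfl⟩

/-- `A ⊆ cs A`. [folklore] -/
theorem subset_cs (A : Finset (Site d)) : A ⊆ cs A := fun x hx =>
  mem_cs.2 ⟨x, hx, 0, zero_mem_cube01 d, (add_zero x).symm⟩

/-- `|cs A| ≤ 2^d |A|`. [folklore] -/
theorem card_cs_le (A : Finset (Site d)) : #(cs A) ≤ 2 ^ d * #A := by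
  rw [cs]
  refine card_image_le.trans ?_
  rw [card_product, card_cube01, mul_comm]

/-- The encoding of a non-empty set is non-empty. [folklore] -/
theorem cs_nonempty {A : Finset (Site d)} (h : A.Nonempty) : (cs A).Nonempty :=
  h.mono (subset_cs A)

/-- The encoding is monotone. [folklore] -/
theorem cs_mono {A B : Finset (Site d)} (h : A ⊆ B) : cs A ⊆ cs B := fun y hy => by
  obtain ⟨x, hx, a, ha, rfl⟩ := mem_cs.1 hy
  exact mem_cs.2 ⟨x, h hx, a, ha, rfl⟩

/-- Two points are at `d_∞`-distance `≤ 1` iff their corner cubes meet. [folklore] -/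
theorem supDist_le_one_iff_exists_corner {x y : Site d} :
    supDist x y ≤ 1 ↔ ∃ a ∈ cube01 d, ∃ b ∈ cube01 d, x + a = y + b := by
  constructor
  · intro h
    rw [supDist_le_iff] at h
    refine ⟨fun i => if x i ≤ y i then y i - x i else 0, mem_cube01.2 fun i => ?_,
      fun i => if x i ≤ y i then 0 else x i - y i, mem_cube01.2 fun i => ?_, funext fun i => ?_⟩
    · have := h i; split_ifs <;> omega
    · have := h i; split_ifs <;> omega
    · simp only [Pi.add_apply]; split_ifs <;> omega
  · rintro ⟨a, ha, b, hb, heq⟩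
    rw [supDist_le_iff]
    intro i
    have h1 := congrFun heq i
    simp only [Pi.add_apply] at h1
    rcases mem_cube01.1 ha i with h2 | h2 <;> rcases mem_cube01.1 hb i with h3 | h3 <;> omega

/-- **Encodings meet iff the sets are at `d_∞`-distance `≤ 1`.**
[cite: FriedliVelenik2017, §7.3 (remark after eq. (7.34))] -/
theorem not_disjoint_cs_iff {A B : Finset (Site d)} :
    ¬ Disjoint (cs A) (cs B) ↔ ∃ x ∈ A, ∃ y ∈ B, supDist x y ≤ 1 := by
  rw [not_disjoint_iff]
  constructor
  · rintro ⟨z, hzA, hzB⟩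
    obtain ⟨x, hx, a, ha, rfl⟩ := mem_cs.1 hzA
    obtain ⟨y, hy, b, hb, heq⟩ := mem_cs.1 hzB
    exact ⟨x, hx, y, hy, supDist_le_one_iff_exists_corner.2 ⟨a, ha, b, hb, heq⟩⟩
  · rintro ⟨x, hx, y, hy, hxy⟩
    obtain ⟨a, ha, b, hb, heq⟩ := supDist_le_one_iff_exists_corner.1 hxy
    exact ⟨x + a, mem_cs.2 ⟨x, hx, a, ha, rfl⟩, mem_cs.2 ⟨y, hy, b, hb, heq⟩⟩

/-- **Compatibility of contours is disjointness of the encoded supports.**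
[cite: FriedliVelenik2017, Def. 7.21 and the remark after eq. (7.34)] -/
theorem ContourSetup.compat_iff_disjoint_cs {S : ContourSetup d} {γ γ' : S.Γ} :
    S.Compat γ γ' ↔ Disjoint (cs (S.supp γ)) (cs (S.supp γ')) := by
  rw [← not_iff_not, not_disjoint_cs_iff, ContourSetup.Compat]
  simp only [not_forall, not_lt, exists_prop]

/-- The shrunk volume `Vhat V = ⋂_{a ∈ {0,1}^d} (V + a) = {x : x - a ∈ V for all a ∈ {0,1}^d}`.
[cite: FriedliVelenik2017, §7.3, eq. (7.48) (families with d_∞(γ̄, Λᶜ) > 1)] -/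
def Vhat (V : Finset (Site d)) : Finset (Site d) := V.filter fun x => ∀ a ∈ cube01 d, x - a ∈ V

/-- Membership in `Vhat`. [folklore] -/
theorem mem_Vhat {V : Finset (Site d)} {x : Site d} : x ∈ Vhat V ↔ ∀ a ∈ cube01 d, x - a ∈ V := by
  rw [Vhat, mem_filter]
  exact ⟨fun h => h.2, fun h => ⟨by simpa using h 0 (zero_mem_cube01 d), h⟩⟩

/-- `Vhat V ⊆ V`. [folklore] -/
theorem Vhat_subset (V : Finset (Site d)) : Vhat V ⊆ V := filter_subset _ _

/-- A point of the ball decomposes as `x + a - b` with `a, b ∈ {0,1}^d`. [folklore] -/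
theorem exists_corner_sub_of_mem_starBall {x z : Site d} (hz : z ∈ starBall x) :
    ∃ a ∈ cube01 d, ∃ b ∈ cube01 d, z = x + a - b := by
  obtain ⟨a, ha, b, hb, heq⟩ := supDist_le_one_iff_exists_corner.1 (mem_starBall.1 hz)
  exact ⟨a, ha, b, hb, by rw [heq]; abel⟩

/-- **`d_∞(A, Vᶜ) > 1` iff `cs A ⊆ Vhat V`.** [cite: FriedliVelenik2017, §7.3, eq. (7.48)] -/
theorem biUnion_starBall_subset_iff {A V : Finset (Site d)} : A.biUnion starBall ⊆ V ↔ cs A ⊆ Vhat V := by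
  constructor
  · intro h y hy
    obtain ⟨x, hx, a, ha, rfl⟩ := mem_cs.1 hy
    refine mem_Vhat.2 fun b hb => h (mem_biUnion.2 ⟨x, hx, mem_starBall.2 ?_⟩)
    exact supDist_le_one_iff_exists_corner.2 ⟨a, ha, b, hb, by abel⟩
  · intro h z hz
    obtain ⟨x, hx, hzx⟩ := mem_biUnion.1 hz
    obtain ⟨a, ha, b, hb, rfl⟩ := exists_corner_sub_of_mem_starBall hzx
    exact mem_Vhat.1 (h (mem_cs.2 ⟨x, hx, a, ha, rfl⟩)) b hb

/-- A contour lies in `V` iff its encoded support lies in `Vhat V`. [cite: FriedliVelenik2017, §7.3, eq. (7.48)] -/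
theorem ContourSetup.inVol_iff_cs_subset {S : ContourSetup d} {γ : S.Γ} {V : Finset (Site d)} :
    S.InVol γ V ↔ cs (S.supp γ) ⊆ Vhat V :=
  biUnion_starBall_subset_iff

/-- `V ∖ Vhat V` lies in the interior `★`-boundary of `V`. [folklore] -/
theorem sdiff_Vhat_subset_inBoundary (V : Finset (Site d)) : V \ Vhat V ⊆ inBoundary V := by
  intro x hx
  rw [mem_sdiff, mem_Vhat] at hx
  obtain ⟨hxV, h⟩ := hx
  push Not at h
  obtain ⟨a, ha, hxa⟩ := h
  refine mem_inBoundary.2 ⟨hxV, x - a, hxa, adj_iff_mem_starBall.2 ⟨mem_starBall.2 ?_, fun h' => hxa (h' ▸ hxV)⟩⟩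
  exact supDist_le_one_iff_exists_corner.2 ⟨0, zero_mem_cube01 d, a, ha, by abel⟩

/-! ### Midpoints, geodesics and boundary layers for `d_∞` -/

/-- **Clamping**: if `d_∞(x, y) ≤ D + 1` there is a point within `D` of `x` and within `1` of `y`
(move each coordinate of `y` back into the `D`-cube around `x`). [folklore] -/
theorem exists_clamp {x y : Site d} (D : ℕ) (h : supDist x y ≤ D + 1) :
    ∃ z, supDist x z ≤ D ∧ supDist z y ≤ 1 := by
  rw [supDist_le_iff] at h
  refine ⟨fun i => x i + max (-(D : ℤ)) (min (D : ℤ) (y i - x i)), supDist_le_iff.2 fun i => ?_,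
    supDist_le_iff.2 fun i => ?_⟩
  · rcases le_total (D : ℤ) (y i - x i) with h1 | h1
    · rw [min_eq_left h1, max_eq_right (by omega)]; omega
    · rw [min_eq_right h1]
      rcases le_total (-(D : ℤ)) (y i - x i) with h2 | h2
      · rw [max_eq_right h2]; omega
      · rw [max_eq_left h2]; omega
  · have := h i
    rcases le_total (D : ℤ) (y i - x i) with h1 | h1
    · rw [min_eq_left h1, max_eq_right (by omega)]; omega
    · rw [min_eq_right h1]
      rcases le_total (-(D : ℤ)) (y i - x i) with h2 | h2
      · rw [max_eq_right h2]; omega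
      · rw [max_eq_left h2]; omega

/-- Two points at `d_∞`-distance `≤ 2` have a common `★`-neighbour. [folklore] -/
theorem exists_midpoint {x w : Site d} (h : supDist x w ≤ 2) : ∃ m, supDist x m ≤ 1 ∧ supDist m w ≤ 1 :=
  exists_clamp 1 h

/-- **The `d_∞`-geodesic lemma**: from a point of `T` to a point outside `T`, some point of the
interior `★`-boundary of `T` is met strictly before the end. [folklore] -/
theorem exists_inBoundary_near {T : Finset (Site d)} {x : Site d} (hx : x ∈ T) :
    ∀ (n : ℕ) (y : Site d), supDist x y ≤ n → y ∉ T → ∃ b ∈ inBoundary T, supDist x b + 1 ≤ supDist x y := by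
  intro n
  induction n with
  | zero =>
    intro y hy hyT
    exact absurd hx (by rwa [eq_of_supDist_eq_zero (Nat.le_zero.1 hy)])
  | succ n ih =>
    intro y hy hyT
    by_cases hlt : supDist x y ≤ n
    · exact ih y hlt hyT
    · obtain ⟨z, hz1, hz2⟩ := exists_clamp n (show supDist x y ≤ n + 1 by omega)
      by_cases hzT : z ∈ T
      · have hzy : z ≠ y := fun h => hyT (h ▸ hzT)
        refine ⟨z, mem_inBoundary.2 ⟨hzT, y, hyT, zdStar_adj.2 ⟨hzy, hz2⟩⟩, ?_⟩
        omega
      · obtain ⟨b, hb, hb'⟩ := ih z hz1 hzT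
        exact ⟨b, hb, by omega⟩

/-- **The boundary of the shrunk volume is near the boundary**: every point of `∂^in (Vhat V)`
lies in the `★`-ball of a point of `∂^in V`; hence `|∂^in (Vhat V)| ≤ 3^d |∂^in V|`. [folklore] -/
theorem card_inBoundary_Vhat_le (V : Finset (Site d)) : #(inBoundary (Vhat V)) ≤ 3 ^ d * #(inBoundary V) := by
  have hsub : inBoundary (Vhat V) ⊆ (inBoundary V).biUnion starBall := by
    intro x hx
    obtain ⟨hxV, y, hyV, hxy⟩ := mem_inBoundary.1 hx
    have hxV' : x ∈ V := Vhat_subset V hxV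
    -- a point `w ∉ V` with `d_∞(x, w) ≤ 2`
    obtain ⟨w, hwV, hxw⟩ : ∃ w, w ∉ V ∧ supDist x w ≤ 2 := by
      by_cases hyV' : y ∈ V
      · have : ¬ ∀ a ∈ cube01 d, y - a ∈ V := fun h => hyV (mem_Vhat.2 h)
        push Not at this
        obtain ⟨a, ha, hya⟩ := this
        refine ⟨y - a, hya, ?_⟩
        have h1 : supDist x y ≤ 1 := (zdStar_adj.1 hxy).2
        have h2 : supDist y (y - a) ≤ 1 := supDist_le_one_iff_exists_corner.2 ⟨0, zero_mem_cube01 d, a, ha, by abel⟩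
        rw [supDist_le_iff] at h1 h2 ⊢
        intro i; have := h1 i; have := h2 i; omega
      · exact ⟨y, hyV', (zdStar_adj.1 hxy).2.trans (by norm_num)⟩
    obtain ⟨b, hb, hb'⟩ := exists_inBoundary_near hxV' 2 w hxw hwV
    refine mem_biUnion.2 ⟨b, hb, mem_starBall.2 ?_⟩
    rw [supDist_comm]; omega
  refine (card_le_card hsub).trans (card_biUnion_le.trans ?_)
  rw [mul_comm, sum_const_nat fun b _ => card_starBall b]

/-- The `d_∞`-ball of radius `k` has `(2k+1)^d` points. [folklore] -/
theorem card_filter_supDist_le (T : Finset (Site d)) (b : Site d) (k : ℕ) :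
    #(T.filter fun x => supDist x b ≤ k) ≤ (2 * k + 1) ^ d := by
  have hsub : T.filter (fun x => supDist x b ≤ k) ⊆ (box d k).image (b + ·) := by
    intro x hx
    obtain ⟨-, hxb⟩ := mem_filter.1 hx
    rw [supDist_le_iff] at hxb
    refine mem_image.2 ⟨x - b, mem_box.2 fun i => ?_, by abel⟩
    have := hxb i
    simp only [Pi.sub_apply]
    omega
  refine (card_le_card hsub).trans (card_image_le.trans ?_)
  rw [card_box]

/-- `2k + 1 ≤ 3^k`. [folklore] -/
theorem two_mul_add_one_le_three_pow (k : ℕ) : 2 * k + 1 ≤ 3 ^ k := by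
  induction k with
  | zero => simp
  | succ k ih => rw [pow_succ]; omega

/-- **The exponential boundary sum**: for `δ ≥ 2d + 1` and any finite `T`,
`Σ_{x ∈ T} e^{-δ d_∞(x, b)} ≤ 2`. [cite: FriedliVelenik2017, Thm. 7.29, proof of eq. (7.54) (boundary terms)] -/
theorem sum_exp_neg_mul_supDist_le {δ : ℝ} (hδ : 2 * d + 1 ≤ δ) (T : Finset (Site d)) (b : Site d) :
    ∑ x ∈ T, Real.exp (-δ * supDist x b) ≤ 2 := by
  -- group by the distance `k`
  set K := T.sup fun x => supDist x b with hK
  have hfib : ∑ x ∈ T, Real.exp (-δ * supDist x b) =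
      ∑ k ∈ range (K + 1), ∑ x ∈ T with supDist x b = k, Real.exp (-δ * supDist x b) := by
    rw [sum_fiberwise_of_maps_to]
    intro x hx
    exact mem_range.2 (Nat.lt_succ_of_le (le_sup (f := fun x => supDist x b) hx))
  rw [hfib]
  have h3 : (3 : ℝ) ≤ Real.exp 2 := by have := Real.add_one_le_exp (2 : ℝ); linarith
  have hterm : ∀ k ∈ range (K + 1), ∑ x ∈ T with supDist x b = k, Real.exp (-δ * supDist x b) ≤ Real.exp (-1) ^ k := by
    intro k _
    calc ∑ x ∈ T with supDist x b = k, Real.exp (-δ * supDist x b)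
        = ∑ x ∈ T with supDist x b = k, Real.exp (-δ * k) := sum_congr rfl fun x hx => by rw [(mem_filter.1 hx).2]
      _ = #(T.filter fun x => supDist x b = k) * Real.exp (-δ * k) := by rw [sum_const, nsmul_eq_mul]
      _ ≤ (2 * k + 1 : ℕ) ^ d * Real.exp (-δ * k) := by
          gcongr
          exact_mod_cast (card_le_card (fun x hx => mem_filter.2 ⟨(mem_filter.1 hx).1, le_of_eq (mem_filter.1 hx).2⟩)).trans
            (card_filter_supDist_le T b k)
      _ ≤ (3 : ℝ) ^ (d * k) * Real.exp (-δ * k) := by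
          refine mul_le_mul_of_nonneg_right ?_ (Real.exp_nonneg _)
          have : (2 * k + 1 : ℕ) ≤ 3 ^ k := two_mul_add_one_le_three_pow k
          calc ((2 * k + 1 : ℕ) : ℝ) ^ d ≤ ((3 : ℝ) ^ k) ^ d := pow_le_pow_left₀ (by positivity) (by exact_mod_cast this) d
            _ = (3 : ℝ) ^ (d * k) := by rw [← pow_mul, mul_comm]
      _ ≤ Real.exp 2 ^ (d * k) * Real.exp (-δ * k) := by gcongr
      _ = Real.exp ((2 * d - δ) * k) := by rw [← Real.exp_nat_mul, ← Real.exp_add]; push_cast; ring_nf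
      _ ≤ Real.exp (-1) ^ k := by
          rw [← Real.exp_nat_mul]
          exact Real.exp_le_exp.2 (by nlinarith [(Nat.cast_nonneg k : (0 : ℝ) ≤ k)])
  refine (sum_le_sum hterm).trans ?_
  have he : Real.exp (-1) ≤ 1 / 2 := by
    rw [Real.exp_neg]
    have := Real.add_one_le_exp (1 : ℝ)
    rw [inv_le_comm₀ (Real.exp_pos 1) (by norm_num)]
    linarith
  have hlt : Real.exp (-1) < 1 := Real.exp_lt_one_iff.2 (by norm_num)
  calc ∑ k ∈ range (K + 1), Real.exp (-1) ^ k = (1 - Real.exp (-1) ^ (K + 1)) / (1 - Real.exp (-1)) := by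
        rw [geom_sum_eq hlt.ne, div_eq_div_iff (sub_ne_zero.2 hlt.ne) (sub_ne_zero.2 hlt.ne')]
        ring
    _ ≤ 1 / (1 - Real.exp (-1)) :=
        div_le_div_of_nonneg_right (by linarith [pow_nonneg (Real.exp_nonneg (-1)) (K + 1)]) (by linarith)
    _ ≤ 2 := by
        rw [div_le_iff₀ (by linarith)]
        linarith

/-- **The weighted boundary sum** (the boundary term `Δ` of FV eq. (7.54) for an arbitrary finite
volume): for `δ ≥ 2d + 1`,
`Σ_{x ∈ T} e^{-δ (r(x) + 2)} ≤ 2 e^{-2δ} |∂^in T|`, where `r(x) = d_∞(x, ∂^in T)`.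
[cite: FriedliVelenik2017, Thm. 7.29, eq. (7.54) (|Δ| ≤ η |∂^in Λ|)] -/
theorem sum_exp_boundaryDist_le {δ : ℝ} (hδ : 2 * d + 1 ≤ δ) (T : Finset (Site d)) (hT : (inBoundary T).Nonempty) :
    ∑ x ∈ T, Real.exp (-δ * ((((inBoundary T).image fun b => supDist x b).min' (hT.image _) : ℕ) + 2)) ≤
      2 * Real.exp (-2 * δ) * #(inBoundary T) := by
  calc ∑ x ∈ T, Real.exp (-δ * ((((inBoundary T).image fun b => supDist x b).min' (hT.image _) : ℕ) + 2))
      ≤ ∑ x ∈ T, ∑ b ∈ inBoundary T, Real.exp (-δ * (supDist x b + 2)) := by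
        refine sum_le_sum fun x _ => ?_
        obtain ⟨b, hb, hbeq⟩ := mem_image.1 (min'_mem ((inBoundary T).image fun b => supDist x b) (hT.image _))
        refine le_trans (le_of_eq ?_) (single_le_sum (fun b _ => Real.exp_nonneg _) hb)
        rw [← hbeq]
    _ = Real.exp (-2 * δ) * ∑ b ∈ inBoundary T, ∑ x ∈ T, Real.exp (-δ * supDist x b) := by
        rw [sum_comm, mul_sum]
        refine sum_congr rfl fun b _ => ?_
        rw [mul_sum]
        refine sum_congr rfl fun x _ => ?_
        rw [← Real.exp_add]; ring_nf
    _ ≤ Real.exp (-2 * δ) * ∑ b ∈ inBoundary T, (2 : ℝ) := by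
        gcongr with b hb
        exact sum_exp_neg_mul_supDist_le hδ T b
    _ = 2 * Real.exp (-2 * δ) * #(inBoundary T) := by rw [sum_const, nsmul_eq_mul]; ring

/-- A non-empty finite set has a non-empty interior `★`-boundary (`d ≥ 1`). [folklore] -/
theorem inBoundary_nonempty (hd : 1 ≤ d) {T : Finset (Site d)} (hT : T.Nonempty) : (inBoundary T).Nonempty := by
  set i : Fin d := ⟨0, hd⟩
  obtain ⟨x, hx, hmax⟩ := exists_max_image T (fun x => x i) hT
  refine ⟨x, mem_inBoundary.2 ⟨hx, Function.update x i (x i + 1), fun h => ?_, ?_⟩⟩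
  · have := hmax _ h; simp at this
  · have := adj_update_succ x i (x i)
    rwa [Function.update_eq_self] at this

/-! ### The hull of a contour lies in the coordinate box of its support -/

/-- **Coordinate projections of a `★`-connected set are integer intervals** (discrete intermediate
value theorem along a `★`-chain). [folklore] -/
theorem exists_apply_eq_of_starConn {A : Finset (Site d)} (hA : StarConn (A : Set (Site d))) (i : Fin d)
    {a b : Site d} (ha : a ∈ A) (hb : b ∈ A) {c : ℤ} (hac : a i ≤ c) (hcb : c ≤ b i) : ∃ z ∈ A, z i = c := by
  have hchain := hA a (mem_coe.2 ha) b (mem_coe.2 hb)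
  -- along the chain every value between `a i` and the current coordinate is attained
  suffices key : ∀ w, ReflTransGen (starRel (A : Set (Site d))) a w →
      ∀ c, min (a i) (w i) ≤ c → c ≤ max (a i) (w i) → ∃ z ∈ A, z i = c from
    key b hchain c (by rw [min_le_iff]; exact Or.inl hac) (by rw [le_max_iff]; exact Or.inr hcb)
  intro w hw
  induction hw with
  | refl => intro c h1 h2; exact ⟨a, ha, by simp at h1 h2; omega⟩
  | @tail z w _ hzw ih =>
    intro c h1 h2
    have hstep := natAbs_sub_le_one_of_adj hzw.1 i
    by_cases hc : min (a i) (z i) ≤ c ∧ c ≤ max (a i) (z i)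
    · exact ih c hc.1 hc.2
    · refine ⟨w, mem_coe.1 hzw.2.2, ?_⟩
      rw [not_and_or, not_le, not_le] at hc
      rw [min_le_iff] at h1
      rw [le_max_iff] at h2
      rcases hc with hc | hc
      · have := min_le_left (a i) (z i); have := min_le_right (a i) (z i); omega
      · have := le_max_left (a i) (z i); have := le_max_right (a i) (z i); omega

/-- A point above the coordinate box of `A` in some direction is exterior to `A`. [folklore] -/
theorem mem_starExt_of_forall_lt (hd : 2 ≤ d) {A : Finset (Site d)} {z : Site d} (i : Fin d)
    (h : ∀ x ∈ A, x i < z i) : z ∈ starExt A := by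
  set R := max (boxRadius A) (univ.sup fun j => (z j).natAbs) with hR
  have hAR : A ⊆ box d R := (subset_box_boxRadius A).trans (box_mono d (le_max_left _ _))
  refine (mem_starExt_iff hd hAR).2 ⟨fun hz => lt_irrefl _ (h z hz), Function.update z i (z i + (2 * R + 1 : ℕ)), ?_, ?_⟩
  · refine ⟨i, ?_⟩
    rw [Function.update_self]
    have : (z i).natAbs ≤ R := (le_sup (f := fun j => (z j).natAbs) (mem_univ i)).trans (le_max_right _ _)
    omega
  · refine reflTransGen_update_add z i (2 * R + 1) fun m _ hm => ?_
    have hlt := h _ (mem_coe.1 hm)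
    rw [Function.update_self] at hlt
    omega

/-- A point below the coordinate box of `A` in some direction is exterior to `A`. [folklore] -/
theorem mem_starExt_of_forall_gt (hd : 2 ≤ d) {A : Finset (Site d)} {z : Site d} (i : Fin d)
    (h : ∀ x ∈ A, z i < x i) : z ∈ starExt A := by
  set R := max (boxRadius A) (univ.sup fun j => (z j).natAbs) with hR
  have hAR : A ⊆ box d R := (subset_box_boxRadius A).trans (box_mono d (le_max_left _ _))
  refine (mem_starExt_iff hd hAR).2 ⟨fun hz => lt_irrefl _ (h z hz), Function.update z i (z i - (2 * R + 1 : ℕ)), ?_, ?_⟩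
  · refine ⟨i, ?_⟩
    rw [Function.update_self]
    have : (z i).natAbs ≤ R := (le_sup (f := fun j => (z j).natAbs) (mem_univ i)).trans (le_max_right _ _)
    omega
  · refine reflTransGen_update_sub z i (2 * R + 1) fun m _ hm => ?_
    have hlt := h _ (mem_coe.1 hm)
    rw [Function.update_self] at hlt
    omega

/-- **The hull lies in the coordinate box of the support**, whose sides have at most `|supp|` points
for a `★`-connected support; hence `|hull γ| ≤ |γ̄|^d`.
[cite: FriedliVelenik2017, §7.4.3 (unstable contours have large supports; here the trivial isoperimetry)] -/
theorem ContourSetup.card_hull_le_pow (hd : 2 ≤ d) {S : ContourSetup d} (γ : S.Γ) : #(S.hull γ) ≤ S.size γ ^ d := by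
  set A := S.supp γ with hAdef
  have hne : A.Nonempty := S.supp_nonempty γ
  -- the coordinate projections
  set lo : Site d := fun i => (A.image fun x => x i).min' (hne.image _) with hlo
  set hi : Site d := fun i => (A.image fun x => x i).max' (hne.image _) with hhi
  have hbox : S.hull γ ⊆ Finset.Icc lo hi := by
    intro z hz
    rw [Finset.mem_Icc]
    by_contra hzb
    rw [not_and_or, Pi.le_def, Pi.le_def, not_forall, not_forall] at hzb
    apply (mem_starHullFinset hd).1 hz
    rcases hzb with ⟨i, hi'⟩ | ⟨i, hi'⟩
    · refine mem_starExt_of_forall_gt hd i fun x hx => lt_of_lt_of_le (not_le.1 hi') ?_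
      exact min'_le _ _ (mem_image_of_mem (fun x => x i) hx)
    · refine mem_starExt_of_forall_lt hd i fun x hx => lt_of_le_of_lt ?_ (not_le.1 hi')
      exact le_max' _ _ (mem_image_of_mem (fun x => x i) hx)
  refine (card_le_card hbox).trans ?_
  rw [Pi.card_Icc]
  calc ∏ i, #(Finset.Icc (lo i) (hi i)) ≤ ∏ _i : Fin d, S.size γ := by
        refine prod_le_prod (fun i _ => Nat.zero_le _) fun i _ => ?_
        -- the `i`-th side `[lo i, hi i] ⊆ ℤ` has at most `|A|` points, by the interval property
        have hsub : Finset.Icc (lo i) (hi i) ⊆ A.image (fun x => x i) := by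
          intro c hc
          rw [Finset.mem_Icc] at hc
          obtain ⟨a, ha, hai⟩ := mem_image.1 (min'_mem (A.image fun x => x i) (hne.image _))
          obtain ⟨b, hb, hbi⟩ := mem_image.1 (max'_mem (A.image fun x => x i) (hne.image _))
          obtain ⟨z, hz, hzi⟩ := exists_apply_eq_of_starConn (c := c) (S.supp_starConn γ) i ha hb
            (by rw [hai]; exact hc.1) (by rw [hbi]; exact hc.2)
          exact mem_image.2 ⟨z, hz, hzi⟩
        exact (card_le_card hsub).trans card_image_le
    _ = S.size γ ^ d := by rw [prod_const, card_univ, Fintype.card_fin]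

end Literature.Probability.LatticeModels

end
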